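import Summits.RiemannHypothesis.RiemannHypothesis.Theses.OddSector
import Summits.RiemannHypothesis.RiemannHypothesis.Theorems.OddSectorOddOneSignedWindowsExistence
import Summits.RiemannHypothesis.RiemannHypothesis.Theorems.OddSectorOddOneSignedWindowsDiophantineSelection
import Literature.NumberTheory.LFunctions.WeilOddGroundState
import HarnessLib

/-!
# Skeleton — crux `OddSector.OddOneSignedWindows` (stmt-RiemannHypothesis-17778), line `Sketch`
(crux-ideate r1-k1, card A `resonance-transport-diophantine`, reshaped by lead c1, 2026-08-17)

History of the slug. The previous lead (c0) drove the r1-k2 file of the same name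
(`log-coercive-origin-layer`) to saturation: landed `stub_foldPrimeIncrement` (p148598),
`stub_smoothFoldRadial` (p149561), `stub_foldArchGain` (p150648), `stub_archGainLiminf` (p150734),
`stub_tendsto_weilPoleForm` (p150388), `stub_originLayerLemma` (p151407),
`stub_oddOneSignedWindows_iff_bulkSignPattern` (p151717); its one open stub `stub_oddBulkSignPattern`
is the crux in robust bulk form (RH-strength). That skeleton is archived as `Lines/Sketch_k2_final.lean`.

This skeleton (card A, reshaped). The card's `IsNonresonantWindow w K a` excluded only the finite
tube family `{(1/k) log (n/m) : n, m ≤ e^{3a}, k ≤ K}`; by the card's own transport mechanism the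
windows `a = log (N/M)` (lowest terms) with `N > e^{3a}` that are reachable by longer words are bad
too and are not excluded, so the card's core `NonresonantIntervalPositivity w K` is (heuristically)
false for every `(w, K)`. The reshaped core lets the exclusion family be ANY non-negative summable
`ψ : ℕ → ℕ → ℝ` with `Σ ψ < 1/2`, chosen per height, with tubes `|a − log (N/M)| < ψ N M` around
all logs of positive rationals; the RH-free selection stub is the countable union bound.

* `stub_diophantineSelection` — RH-free (measure theory): a summable tube family of total length
  `< 1` misses a point of every unit interval. LANDED p154064 (…DiophantineSelection.lean).
* `stub_diophantineCore` — RH-STRENGTH (the crux made interval-robust off the tubes; `≥` the crux).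
* `OddOneSignedWindows_of` — the crux BY NAME from the two stubs.
-/

noncomputable section

set_option linter.dupNamespace false

open Complex Filter Set MeasureTheory
open scoped Real Topology

namespace Summit.RiemannHypothesis.RiemannHypothesis.Theorems.OddSector

open Literature.NumberTheory.LFunctions
open Summit.RiemannHypothesis.RiemannHypothesis.Theses.OddSector (OddOneSignedWindows)

-- `stub_diophantineSelection` LANDED (wave 1, p154064):
-- `Theorems/OddSectorOddOneSignedWindowsDiophantineSelection.lean`, imported above and used by name below.

/-- **The Diophantine core (RH-strength stub; the crux made interval-robust).** Beyond every
height there is a unit interval of windows `[a₁, a₁ + 1]` and a summable exclusion family `ψ ≥ 0`,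
`Σ ψ < 1/2`, such that every window of the interval off the tubes `|a − log (N/M)| < ψ N M`
(`N, M ≥ 1`) carries an odd-sector ground state that is real and `≥ 0` a.e. on `(0, a)`. -/
theorem stub_diophantineCore :
    ∀ A : ℝ, ∃ a₁ : ℝ, A ≤ a₁ ∧ ∃ ψ : ℕ → ℕ → ℝ, (∀ N M, 0 ≤ ψ N M) ∧
      Summable (fun p : ℕ × ℕ => ψ p.1 p.2) ∧ ∑' p : ℕ × ℕ, ψ p.1 p.2 < 1 / 2 ∧
      ∀ a ∈ Icc a₁ (a₁ + 1),
        (∀ N M : ℕ, 1 ≤ N → 1 ≤ M → ψ N M ≤ |a - Real.log ((N : ℝ) / M)|) →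
          ∃ u : ℝ → ℂ, IsWeilOddGroundState a u ∧
            ∀ᵐ t : ℝ, t ∈ Ioo 0 a → (u t).im = 0 ∧ 0 ≤ (u t).re := by
  sorry

/-- **The crux from the two stubs (kernel-checked composition).** Given a height `A`, the core
supplies an interval `[a₁, a₁ + 1]` beyond `A` with its exclusion family `ψ`; Diophantine
selection supplies a window `a` of the interval off all tubes; the core's ground state at `a` is the
one-signed odd bottom state the crux asks for. -/
theorem OddOneSignedWindows_of : OddOneSignedWindows := by
  rw [oddOneSignedWindows_iff]
  intro A
  obtain ⟨a₁, hAa₁, ψ, hψ0, hψs, hψlt, hcore⟩ := stub_diophantineCore A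
  obtain ⟨a, ha, hnr⟩ := stub_diophantineSelection ψ hψ0 hψs hψlt a₁
  obtain ⟨u, hu, hsign⟩ := hcore a ha hnr
  exact ⟨a, le_trans hAa₁ ha.1, u, hu, hsign⟩

end Summit.RiemannHypothesis.RiemannHypothesis.Theorems.OddSector

end
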